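import Literature.AlgebraicGeometry.Resolution.LipmanProcedure
import HarnessLib

/-!
# `SharpStrata.SepExcModels`, line `birth`: the normalised blow-up of a closed proper centre

Route `ResolutionOfSingularities/SharpStrata`, crux `SepExcModels`
(stmt-ResolutionOfSingularities-16828), stub `stub_normalizedBlowup` of the lead's skeleton
`Cruxes/SepExcModels/Lines/birth.lean`, PROVED here (statement verbatim from the registration).

**Statement.** Let `k` be a field, `Y` an integral scheme and `f : Y → Spec k` locally of finite
type, and let `Z ⊊ Y` be a closed subset. Then there are an integral scheme `Y'` and a morphism
`π : Y' → Y` which is the composite `Y' ≅ (Bl_Z Y)^ν → Bl_Z Y → Y` of the normalization of a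
blow-up `β : B = Bl_Z Y → Y` of `Y` along the vanishing (reduced) ideal sheaf of `Z`, with `B`
integral, and `π` is proper and birational.

**Proof** (tree glue; this is one step of the Kolchin phase = Lipman's step `lipmanStep` of
`Literature/AlgebraicGeometry/Resolution/LipmanProcedure.lean` with the reduced singular locus
replaced by an arbitrary closed proper centre `Z`).
* `J := vanishingIdeal Z ≠ ⊥`: the support of `vanishingIdeal Z` is `Z`
  (`coe_support_vanishingIdeal`) while the support of `⊥` is everything (`support_bot`), and
  `Z ≠ Y`.
* `B := blowup J`, `β := blowup.π J` is a blow-up (`blowup.isBlowup`); `B` is integral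
  (`IsBlowup.isIntegral`, Stacks 02ND, needs `J ≠ ⊥`), `β` is proper (`IsBlowup.isProper`,
  Stacks 02NS; `Y` is locally Noetherian, being locally of finite type over a field) and
  birational (`IsBlowup.isBirational'`).
* `Y' := normalization B`, `π := normalizationι B ≫ β`, `e := Iso.refl`. The normalization of the
  variety `B` (structure map `β ≫ f`, locally of finite type) is finite
  (`isFinite_normalizationι` with `NoetherFiniteIntegralClosure_holds`; Liu 2002, Cor. 4.1.30),
  hence proper, and birational (`isBirational_normalizationι`); proper and birational morphisms
  compose (`IsBirational.comp`).
-/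

noncomputable section

open CategoryTheory AlgebraicGeometry TopologicalSpace Topology
open Literature.AlgebraicGeometry.Resolution

-- single-problem summit: the doubled namespace component is forced
set_option linter.dupNamespace false

namespace Summit.ResolutionOfSingularities.ResolutionOfSingularities.Theorems.SepExcModels.NormalizedBlowup

/-- The vanishing (reduced) ideal sheaf of a closed subset `Z ≠ Y` is non-zero: its support is
`Z` (`coe_support_vanishingIdeal`), whereas the support of the zero ideal sheaf is all of `Y`.
[folklore] -/
theorem vanishingIdeal_ne_bot {Y : Scheme.{0}} (Z : TopologicalSpace.Closeds Y)
    (hZ : (Z : Set Y) ≠ Set.univ) : Scheme.IdealSheafData.vanishingIdeal Z ≠ ⊥ := by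
  intro h
  apply hZ
  rw [← Scheme.IdealSheafData.coe_support_vanishingIdeal Z, h,
    Scheme.IdealSheafData.support_bot]
  rfl

/-- **The normalised blow-up of a closed proper centre** (one step of the Kolchin phase; cf.
Lipman's step, Liu 2002, §8.3.4 (3.11)): for `Y` integral and locally of finite type over a
field and `Z ⊊ Y` closed, the composite `(Bl_Z Y)^ν → Bl_Z Y → Y` of the blow-up of the
vanishing ideal sheaf of `Z` (integral source, Stacks 02ND; proper, Stacks 02NS; birational) and
the normalization of `Bl_Z Y` (finite, Liu 2002 Cor. 4.1.30, hence proper; birational) is a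
proper birational morphism from an integral scheme.
[cite: StacksProject, Tag 02NS and Tag 02ND; Liu2002, Cor. 4.1.30 and §8.3.4 (3.11)] -/
theorem stub_normalizedBlowup (k : Type) [Field k] (Y : Scheme.{0}) [IsIntegral Y]
    (f : Y ⟶ Spec (.of k)) [LocallyOfFiniteType f] (Z : TopologicalSpace.Closeds Y)
    (hZ : (Z : Set Y) ≠ Set.univ) :
    ∃ (Y' : Scheme.{0}) (_ : IsIntegral Y') (π : Y' ⟶ Y),
      (∃ (B : Scheme.{0}) (β : B ⟶ Y) (_ : IsIntegral B) (e : Y' ≅ normalization B),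
          IsBlowup β (Scheme.IdealSheafData.vanishingIdeal Z) ∧
            e.hom ≫ normalizationι B ≫ β = π) ∧
        IsProper π ∧ IsBirational π := by
  haveI : IsLocallyNoetherian Y := LocallyOfFiniteType.isLocallyNoetherian f
  -- the centre: the vanishing (reduced) ideal sheaf of `Z`, non-zero since `Z ≠ Y`
  have hJ : Scheme.IdealSheafData.vanishingIdeal Z ≠ ⊥ := vanishingIdeal_ne_bot Z hZ
  -- the blow-up `β : B = Bl_Z Y → Y`: integral source, proper, birational
  have hβ : IsBlowup (blowup.π (Scheme.IdealSheafData.vanishingIdeal Z))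
      (Scheme.IdealSheafData.vanishingIdeal Z) :=
    blowup.isBlowup _
  haveI : IsIntegral (blowup (Scheme.IdealSheafData.vanishingIdeal Z)) := hβ.isIntegral hJ
  haveI : IsProper (blowup.π (Scheme.IdealSheafData.vanishingIdeal Z)) := hβ.isProper
  -- the normalization of the variety `B` is finite (E. Noether / Liu Cor. 4.1.30), hence proper
  haveI : IsFinite (normalizationι (blowup (Scheme.IdealSheafData.vanishingIdeal Z))) :=
    isFinite_normalizationι (blowup (Scheme.IdealSheafData.vanishingIdeal Z))
      NoetherFiniteIntegralClosure_holds (blowup.π (Scheme.IdealSheafData.vanishingIdeal Z) ≫ f)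
  refine ⟨normalization (blowup (Scheme.IdealSheafData.vanishingIdeal Z)), inferInstance,
    normalizationι (blowup (Scheme.IdealSheafData.vanishingIdeal Z)) ≫
      blowup.π (Scheme.IdealSheafData.vanishingIdeal Z),
    ⟨blowup (Scheme.IdealSheafData.vanishingIdeal Z),
      blowup.π (Scheme.IdealSheafData.vanishingIdeal Z), inferInstance, Iso.refl _, hβ,
      by simp⟩,
    inferInstance, ?_⟩
  -- birational: both halves are, and birational morphisms compose
  exact (isBirational_normalizationι (blowup (Scheme.IdealSheafData.vanishingIdeal Z))
      (blowup.π (Scheme.IdealSheafData.vanishingIdeal Z) ≫ f)).comp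
    (hβ.isBirational' hJ)

end Summit.ResolutionOfSingularities.ResolutionOfSingularities.Theorems.SepExcModels.NormalizedBlowup

end
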